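import Summits.QuantumFields.YangMills.Theorems.BalabanUVNodesN08AlphaEq324RowACZero
import Summits.QuantumFields.YangMills.Theorems.AlphaInputsT3ACv3RecordSelXsChi
import HarnessLib

/-!
# The (α) auxiliary bundle `AlphaAC.AlphaDataAC` behind the registered (O‴χₛ) data schema `DataRowsT3XsChiSel` carries the G3D-07 binder at EVERY `k : ℕ`:
# for constants records with even `r₀ ≥ 2` (profiles `p₀ = 2r₀ + 1 ∈ 4ℕ + 1`) and positive amplitudes `Cfar·C63 > 0` the bundle is EMPTY at every
# lattice approximation — the AC ∕ three-torus twin of `BalabanUVNodesN08AlphaFarCurrency.isEmpty_alphaData_of_r₀_eq_two`, and its consequence for (O‴χₛ)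

Cell `ym3-torus` (YM ladder rung R3 = continuum `SU(2)` Yang–Mills on the three-torus — a RUNG, NOT d = 4, NOT infinite volume, NOT a mass gap, NOT Clay).
Width seat `ym3-torus-px8` (gen 16), ★★OWNER `ym3-torus-plan` g35's (α)-ROW LOCATE SWEEP (2026-08-30), rows #9 `far_le` ∕ G3D-07.  THEOREMS ONLY (def-free,
sorry-free, standard axioms); `--supports stmt-QuantumFields-19936 --as helper`; count-neutral EVIDENCE about the TYPING of the registered row, nothing asserted
about [Balaban1985UV3].

THE LOCATED POINT.  The sister cell `pub-ymgap` (route BalabanUVNodes, node N08, seat dag-n08-d gen 6) proved for the Haar lane that the auxiliary bundle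
`UVStability3DInputs.AlphaData` — whose field `Λc : ∀ k, LogZLocalizedAsCited …` reads G3D-06 `FarTermsDecayAsCited` at EVERY step, also beyond the run —
is EMPTY for records with `r₀ = 2` and `Cfar·C63 > 0`, because `g_k = g√(L^kε)` exceeds `e` at some step (`exists_gk_gt`) and there the seventh-order currency
`g_k⁷(r(g_k)p(g_k))⁷` is negative (`farCurrency_neg_of_r₀_eq_two`), so `|far| ≤ Cfar·C63·e^{−κ𝓛}·(currency) < 0` is unsatisfiable.  The absolutely-continuous
bundle `AlphaAC.AlphaDataAC` has THE SAME field `Λc : ∀ k`, and the three-torus (O‴χₛ) schema `AlphaInputsT3AC.DataRowsT3XsChiSel F 𝔠 γ hγ hγ1 K Ut`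
(`AlphaInputsT3ACv3RecordSelXsChi` :163; the last conjunct of the 19936 registry row `stub_selXsV4DataRows`, text `hrows` b59e80ba) existentially quantifies
`∃ 𝔖 (𝔄 : AlphaDataAC (suGroupModel 2) 𝔠 (XT3 …) 𝔖), …`.  Moreover `AlphaConsts.p₀ := 2r₀ + 1` (ruling R-E2′), so a profile `p₀ = 4m + 1` FORCES `r₀ = 2m`.
* §1 `farCurrency_neg_of_r₀_eq_two_mul` — every EVEN `r₀ = 2m ≥ 2`: the currency is negative at every step with `g_k > e` (`x^{2m}·x^{4m+1} = x·(x^{2m})²·x^{2m} < 0`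
  for `x = 1 + log g_k⁻¹ < 0`; only `Real.rpow_natCast`, no trigonometry).
* §2 ★★ `isEmpty_alphaDataAC_of_r₀_eq_two_mul` — via the sister cell's AC twin ✓`BalabanUVNodesN08AlphaEq324RowACZero.isEmpty_alphaDataAC_of_farCurrency_neg` (imported,
  not restated; its `…_of_r₀_eq_two` is the case `m = 1`).
* §3 `p₀_eq_of_r₀_eq_two_mul` ∕ `r₀_eq_of_p₀_eq` (the profile dictionary) · `exists_profile_ge` (above every `p₁` there is a profile `4m+1`, `m ≥ 1`) ·
  ★★★ `not_dataRowsT3XsChiSel_of_p₀_eq` — at every profile `4m+1`, for every record with `𝔠.p₀ = 4m+1`, `0 < 𝔠.Cfar`, `0 < 𝔠.C63`: `¬ DataRowsT3XsChiSel F 𝔠 γ hγ hγ1 K Ut`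
  for EVERY `F γ K Ut`.
READING (for the post-freeze ∕ NODE O planner; NOT a defect of any landed theorem, NOT a refutation of the registered row — its `∃ 𝔠` may still be met with
`Cfar = 0` or `C63 = 0`): the registered (O‴χₛ) text «∃ b₁ p₁, ∀ b₀ p₀ ≥ (b₁,p₁), ∃ 𝔠, 𝔠.p₀ = p₀ ∧ … ∧ DataRowsT3XsChiSel …» can be inhabited at the profiles
`p₀ ∈ 4ℕ + 1` ONLY by records whose (63)-pieces have ZERO amplitude product `Cfar·C63` — whereas print's pieces are not identically zero.  Repair menu = N08's:
make the bundle range-honest (`BalabanUVNodesN08AlphaEq324RowAC.AlphaDataLTAC`: `Λc ∕ N45` on run steps `k + 1 ≤ K` only), or state G3D-06 with `|c|`.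
HONEST: typing bookkeeping; (α) data rows 0∕23 unchanged; `HistoryTailL` (19936) ∕ (O‴χₛ) ∕ EX NOT proved or refuted; rung R3 = SU(2) YM₃ on T³ — NOT d = 4,
NOT infinite volume, NOT a mass gap, NOT Clay; the Yang–Mills mass gap is NOT proved.

References: T. Bałaban, CMP **102** (1985) 255–275 [Balaban1985UV3] ((7) p.257, p.264 L14–20, (63) p.272).
-/

set_option autoImplicit false

noncomputable section

namespace Summit.QuantumFields.YangMills.Theorems.AlphaInputsT3ACAlphaDataACFarCurrency

open MeasureTheory Metric
open Literature.MathematicalPhysics.QuantumFieldTheory.Balaban1983to89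
open Literature.MathematicalPhysics.QuantumFieldTheory.Balaban1983to89.B10
open Literature.MathematicalPhysics.QuantumFieldTheory.Balaban1983to89.TreeLengthTorus (tsys)
open Literature.MathematicalPhysics.QuantumFieldTheory.Balaban1983to89.T3ContinuumYM3Torus
open Literature.MathematicalPhysics.QuantumFieldTheory.Balaban1985CMP102
open Literature.MathematicalPhysics.QuantumFieldTheory.Balaban1985CMP102.Setting
open Summit.QuantumFields.Balaban3D.Carriers
open Summit.QuantumFields.Balaban3D.Proofs.Primitives (AlphaConsts)
open Summit.QuantumFields.Balaban3D.Proofs.GroupModelLieC (lieC)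
open Summit.QuantumFields.Balaban3D.Proofs.StandardAC
open Summit.QuantumFields.Balaban3D.Proofs.InputsAC
open Summit.QuantumFields.Balaban3D.Proofs.AlphaAC (AlphaDataAC)
open Summit.QuantumFields.Balaban3D.Proofs.ScalesArithmetic (gk_pos)
open Summit.QuantumFields.YangMills.Theorems.BalabanUVNodesN08AlphaFarCurrency (one_add_log_inv_neg exists_gk_gt)
open Summit.QuantumFields.YangMills.Theorems.BalabanUVNodesN08AlphaEq324RowACZero (isEmpty_alphaDataAC_of_farCurrency_neg)

variable {L : ℕ}

/-! ## §1 Every even exponent `r₀ = 2m ≥ 2` is obstructed off the run -/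

section Sign

variable {S : Scales L} {N : ℕ} (𝔠 : AlphaConsts L N)

/-- **EVEN `r₀ = 2m` (so `p₀ = 2r₀ + 1 = 4m + 1`): the far currency is NEGATIVE at every step with `g_k > e`** — with `x = 1 + log g_k⁻¹ < 0`,
`r(g_k)·p(g_k) = x^{2m}·b₀x^{4m+1} = b₀·x·(x^{2m})³ < 0`, an odd power keeps the sign, and `g_k⁷ > 0`.  (`m = 1` is
`BalabanUVNodesN08AlphaFarCurrency.farCurrency_neg_of_r₀_eq_two`.) [cite: Balaban1985UV3, (7) p.257 (r₀ not fixed numerically in print)] -/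
theorem farCurrency_neg_of_r₀_eq_two_mul {m : ℕ} (hr : 𝔠.r₀ = 2 * (m : ℝ)) {k : ℕ} (hg : Real.exp 1 < S.gk k) :
    S.gk k ^ 7 * (rFun 𝔠.r₀ (S.gk k) * pFun 𝔠.b₀ 𝔠.p₀ (S.gk k)) ^ 7 < 0 := by
  have hx := one_add_log_inv_neg hg
  set x : ℝ := 1 + Real.log (S.gk k)⁻¹ with hxdef
  have hp : 𝔠.p₀ = ((4 * m + 1 : ℕ) : ℝ) := by rw [AlphaConsts.p₀, hr]; push_cast; ring
  have hr' : 𝔠.r₀ = ((2 * m : ℕ) : ℝ) := by rw [hr]; push_cast; ring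
  have hrF : rFun 𝔠.r₀ (S.gk k) = x ^ (2 * m) := by rw [rFun, hr', ← hxdef, Real.rpow_natCast]
  have hpF : pFun 𝔠.b₀ 𝔠.p₀ (S.gk k) = 𝔠.b₀ * x ^ (4 * m + 1) := by rw [pFun, hp, ← hxdef, Real.rpow_natCast]
  have hx2m : 0 < x ^ (2 * m) := by
    rw [pow_mul]
    exact pow_pos (by nlinarith [hx]) m
  have hrp : rFun 𝔠.r₀ (S.gk k) * pFun 𝔠.b₀ 𝔠.p₀ (S.gk k) < 0 := by
    rw [hrF, hpF]
    have h41 : x ^ (4 * m + 1) = x * (x ^ (2 * m)) ^ 2 := by ring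
    rw [h41]
    have hneg : x * (x ^ (2 * m)) ^ 2 < 0 := mul_neg_of_neg_of_pos hx (pow_pos hx2m 2)
    have : 𝔠.b₀ * (x * (x ^ (2 * m)) ^ 2) < 0 := mul_neg_of_pos_of_neg 𝔠.b₀_pos hneg
    nlinarith [hx2m, this]
  have h7 : (rFun 𝔠.r₀ (S.gk k) * pFun 𝔠.b₀ 𝔠.p₀ (S.gk k)) ^ 7 < 0 := Odd.pow_neg (by decide) hrp
  exact mul_neg_of_pos_of_neg (pow_pos (gk_pos S k) 7) h7

end Sign

/-! ## §2 Even exponents empty the ABSOLUTELY-CONTINUOUS bundle `AlphaDataAC` (the sister cell's AC twin, imported) -/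

section Empty

variable {S : Scales L} {G : Type} [GaugeGroup G] [MeasurableSpace G] [HaarData G] (𝔊 : GroupModel G) (𝔠 : AlphaConsts L 𝔊.N)
  (X : ExternalInputsAC S G) (𝔖 : ∀ k, StepSeries S G ↥(lieC 𝔊) (nblkOf S 𝔠.lane.carrier k) k)

/-- ★★ **FOR A RECORD WITH EVEN `r₀ = 2m ≥ 2` AND POSITIVE FAR ∕ (63) AMPLITUDES, `AlphaDataAC` IS EMPTY AT EVERY LATTICE APPROXIMATION** (by
`exists_gk_gt` some step has `g_k > e`; there §1 applies). [cite: Balaban1985UV3, (7) p.257 + p.264 L14–20] -/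
theorem isEmpty_alphaDataAC_of_r₀_eq_two_mul (hCfar : 0 < 𝔠.Cfar) (hC63 : 0 < 𝔠.C63) {m : ℕ} (hr : 𝔠.r₀ = 2 * (m : ℝ)) :
    IsEmpty (AlphaDataAC 𝔊 𝔠 X 𝔖) := by
  obtain ⟨k, hk⟩ := exists_gk_gt S (Real.exp 1)
  exact isEmpty_alphaDataAC_of_farCurrency_neg 𝔊 𝔠 X 𝔖 hCfar hC63 (farCurrency_neg_of_r₀_eq_two_mul 𝔠 hr hk)

end Empty

/-! ## §3 The consequence for the three-torus (O‴χₛ) data schema at the profiles `p₀ ∈ 4ℕ + 1` -/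

section Torus

open Summit.QuantumFields.Balaban3D.Proofs

/-- The profile dictionary (ruling R-E2′ `p₀ := 2r₀ + 1`): `r₀ = 2m ⇒ p₀ = 4m + 1`. [cite: Balaban1985UV3, (7) p.257] -/
theorem p₀_eq_of_r₀_eq_two_mul {N : ℕ} (𝔠 : AlphaConsts L N) {m : ℕ} (hr : 𝔠.r₀ = 2 * (m : ℝ)) : 𝔠.p₀ = 4 * (m : ℝ) + 1 := by
  rw [AlphaConsts.p₀, hr]; ring

/-- … and conversely `p₀ = 4m + 1 ⇒ r₀ = 2m`: a pinned profile in `4ℕ + 1` FORCES an even exponent. [cite: Balaban1985UV3, (7) p.257] -/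
theorem r₀_eq_of_p₀_eq {N : ℕ} (𝔠 : AlphaConsts L N) {m : ℕ} (hp : 𝔠.p₀ = 4 * (m : ℝ) + 1) : 𝔠.r₀ = 2 * (m : ℝ) := by
  have h : 2 * 𝔠.r₀ + 1 = 4 * (m : ℝ) + 1 := by rw [← hp, AlphaConsts.p₀]
  linarith

/-- Above every threshold `p₁` there is a profile `4m + 1` with `m ≥ 1` (so the registered «∀ p₀ ≥ p₁» ranges over obstructed profiles). [folklore] -/
theorem exists_profile_ge (p₁ : ℝ) : ∃ m : ℕ, 1 ≤ m ∧ p₁ ≤ 4 * (m : ℝ) + 1 := by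
  obtain ⟨n, hn⟩ := exists_nat_ge p₁
  refine ⟨n + 1, by omega, ?_⟩
  push_cast
  linarith

variable (F : T3Family) (𝔠 : AlphaConsts F.L (suGroupModel 2).N) (γ : ℝ) (hγ : 0 < γ) (hγ1 : γ ≤ (min 𝔠.gamma0 1) ^ 2) (K : ℕ)

/-- ★★★ **AT A PROFILE `p₀ = 4m + 1` (`m ≥ 1`), A RECORD WITH `Cfar·C63 > 0` ADMITS NO (O‴χₛ) DATA: `¬ DataRowsT3XsChiSel F 𝔠 γ hγ hγ1 K Ut` for every
selection `Ut`** — its conjunct `∃ 𝔖 (𝔄 : AlphaDataAC (suGroupModel 2) 𝔠 (XT3 …) 𝔖), …` is empty by §2.  Hence the registered (O‴χₛ) text can be inhabited at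
such profiles only by records with `Cfar = 0` or `C63 = 0`. [cite: Balaban1985UV3, (7) p.257 + (63) p.272 (bookkeeping over the typed schema)] -/
theorem not_dataRowsT3XsChiSel_of_p₀_eq {m : ℕ} (hp : 𝔠.p₀ = 4 * (m : ℝ) + 1) (hCfar : 0 < 𝔠.Cfar) (hC63 : 0 < 𝔠.C63)
    (Ut : (k : ℕ) → GaugeField (F.P K) k (Matrix.specialUnitaryGroup (Fin 2) ℂ) → GaugeField (F.P K) 0 (Matrix.specialUnitaryGroup (Fin 2) ℂ)) :
    ¬ AlphaInputsT3AC.DataRowsT3XsChiSel F 𝔠 γ hγ hγ1 K Ut := by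
  rintro ⟨UkH, hU0, -, 𝔖, 𝔄, -⟩
  exact (isEmpty_alphaDataAC_of_r₀_eq_two_mul (suGroupModel 2) 𝔠 _ 𝔖 hCfar hC63 (r₀_eq_of_p₀_eq 𝔠 hp)).false 𝔄

/-- ★★ The same stated with the exponent: even `r₀ = 2m ≥ 2` and `Cfar·C63 > 0` ⇒ no (O‴χₛ) data at any `F γ K Ut`. [cite: Balaban1985UV3, (7) p.257 + (63) p.272] -/
theorem not_dataRowsT3XsChiSel_of_r₀_eq_two_mul {m : ℕ} (hr : 𝔠.r₀ = 2 * (m : ℝ)) (hCfar : 0 < 𝔠.Cfar) (hC63 : 0 < 𝔠.C63)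
    (Ut : (k : ℕ) → GaugeField (F.P K) k (Matrix.specialUnitaryGroup (Fin 2) ℂ) → GaugeField (F.P K) 0 (Matrix.specialUnitaryGroup (Fin 2) ℂ)) :
    ¬ AlphaInputsT3AC.DataRowsT3XsChiSel F 𝔠 γ hγ hγ1 K Ut :=
  not_dataRowsT3XsChiSel_of_p₀_eq F 𝔠 γ hγ hγ1 K (p₀_eq_of_r₀_eq_two_mul 𝔠 hr) hCfar hC63 Ut

end Torus

end Summit.QuantumFields.YangMills.Theorems.AlphaInputsT3ACAlphaDataACFarCurrency

end
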